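import Summits.ABC.StewartYu.PadicG3TwoFrameNumericsSharp
import HarnessLib

/-!
# Cell abc-stewartyu, Gen-3 frame at `p = 2` (crux `Y07Two`, stmt-ABC-19659), assembly: MONOTONICITY of the frame
# output in the degree box and of the record predicate in `(S₀, X)`, and the registered stub from the numerics
# with a LARGER END box in the record (reconciliation with the dyadic END data of `PadicG3Par`)

`Summits/ABC/StewartYu/PadicG3TwoRecordMono.lean` — cell `abc-stewartyu` (HOME `run/shared/lean/pub/abc-stewartyu/`),
route `PadicPrimesKummerThird`, seat p5 (g3).  Theorems only.

* `frameOutputTwo_mono` — `FrameOutputTwo n α b j₀ D₀ S₀ X D` is monotone UPWARD in `(D₀, D)` (they are upper bounds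
  on the degrees of the frame's auxiliary polynomial);
* `recordTwo_mono` — `RecordTwo C n V Vmax W D₀ S₀ X D` is monotone UPWARD in `(S₀, X)` (clauses (A)/(B) negate
  `binom(S₀+ℓ, ℓ)·(2X+1)·H ≤ …`; clause (C) has it as antecedent);
* **`frameTwoLast_of_numericsD` / `stub_frameTwoLast_of_numericsD`** — p5's `frameTwoLast_of_numericsC` with the
  record allowed at ANY `D₀′ ≥ σ.D₀` and `D′ ≥ snoc (σ.Dbox I*) (σ.Dθ I*)` — so lp-1's `PadicG3Par.recordTwo_of_numeric`
  (dyadic END degrees `P.D`, `P.D₀ = L₀ + 1`) composes with the triadic schedule `schedTwo` (whose END box is smaller).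

WHAT THIS IS NOT: no numbers; no crux moves.

References: Yu. V. Nesterenko, LNM 1819 (2003), §5.1–§5.2; K. Yu, Acta Math. 211 (2013), §6.
-/

noncomputable section

open Finset
open Literature.NumberTheory.Transcendental

namespace Summit.ABC.StewartYu

namespace GenThreeFrameSpecTwo

/-- **`FrameOutputTwo` is monotone in the degree bounds.** [cite: Nesterenko2003, §5.1 (5.1); shape only] -/
theorem frameOutputTwo_mono {n : ℕ} {α : Fin n → ℚ} {b : Fin n → ℤ} {j₀ : Fin n} {D₀ D₀' S₀ X : ℕ}
    {D D' : Fin n → ℕ} (hD₀ : D₀ ≤ D₀') (hD : ∀ j, D j ≤ D' j)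
    (h : FrameOutputTwo n α b j₀ D₀ S₀ X D) : FrameOutputTwo n α b j₀ D₀' S₀ X D' := by
  obtain ⟨I, q, i₀, ha, hκ, hi₀, hq, hL⟩ := h
  refine ⟨I, q, i₀, fun i hi => (ha i hi).trans hD₀, fun i hi j => (hκ i hi j).trans ?_, hi₀, hq, hL⟩
  exact_mod_cast hD j

/-- **`RecordTwo` is monotone in `(S₀, X)`.** [cite: Nesterenko2003, §5.2 (5.14)–(5.17), (5.22); shape only] -/
theorem recordTwo_mono {C : ℕ → ℝ} {n : ℕ} {V : Fin n → ℝ} {Vmax W : ℝ} {D₀ S₀ S₀' X X' : ℕ}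
    {D : Fin n → ℕ} (hS : S₀ ≤ S₀') (hX : X ≤ X')
    (h : RecordTwo C n V Vmax W D₀ S₀ X D) : RecordTwo C n V Vmax W D₀ S₀' X' D := by
  obtain ⟨hA, hB, hC⟩ := h
  -- the common monotone factor `binom(S₀+ℓ, ℓ)·(2X+1)`
  have hmono : ∀ ℓ H : ℕ, Nat.choose (S₀ + ℓ) ℓ * (2 * X + 1) * H ≤ Nat.choose (S₀' + ℓ) ℓ * (2 * X' + 1) * H :=
    fun ℓ H => Nat.mul_le_mul (Nat.mul_le_mul (Nat.choose_le_choose ℓ (by omega)) (by omega)) le_rfl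
  refine ⟨?_, ?_, ?_⟩
  · intro r d₀ M hr hd hM hle
    exact hA r d₀ M hr hd hM ((hmono _ _).trans hle)
  · intro d₀ M hd hM hle
    exact hB d₀ M hd hM ((hmono _ _).trans hle)
  · intro r d₀ M hr hrn hd hM hle κ hκ hdet
    exact hC r d₀ M hr hrn hd hM ((hmono _ _).trans hle) κ hκ hdet

end GenThreeFrameSpecTwo

namespace TwoSetup

variable {S : TwoSetup}

/-- **`FrameTwoLast C d` FROM THE RECORD with a larger END box in the record** (sharp count): as
`frameTwoLast_of_numericsC`, but `RecordTwo` may be verified at any `D₀′ ≥ σ.D₀`, `D′ ≥ snoc (σ.Dbox I*) (σ.Dθ I*)`.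
[cite: Yu2013, §5–§6; shape only] -/
theorem frameTwoLast_of_numericsD {C : ℕ → ℝ} {d : ℕ}
    (h : ∀ (α : Fin (d + 1) → ℚ) (b : Fin (d + 1) → ℤ) (V : Fin (d + 1) → ℝ) (Vmax W : ℝ)
      (hα : ∀ j, 3 ≤ padicValRat 2 (α j - 1)),
      (∀ μ : Fin (d + 1) → ℤ, ∏ j, α j ^ μ j = 1 → μ = 0) →
      (∀ κ : Fin (d + 1) → ℤ, (∃ γ : ℚ, ∏ j, α j ^ κ j = γ ^ 3) → ∀ j, (3 : ℤ) ∣ κ j) →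
      (∀ j, Height.logHeight₁ (α j) ≤ V j) → (∀ j, 1 ≤ V j) → (∀ j, V j ≤ Vmax) →
      ∀ (hb : b (Fin.last d) ≠ 0)
        (hmin : ∀ j, b j ≠ 0 → padicValInt 2 (b (Fin.last d)) ≤ padicValInt 2 (b j)),
      (∀ j, Real.log (max 3 (|b j| : ℝ)) ≤ W) → 1 ≤ W →
      ¬ (padicValRat 2 (∏ j, α j ^ b j - 1) : ℝ) ≤ C (d + 1) * (∏ j, V j) * (W + Real.log (2 * Vmax)) →
      ∃ (σ : (ofData d α b hα hb hmin).G3TwoSched) (H L₀ S₀ X D₀' : ℕ) (D' : Fin (d + 1) → ℕ),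
        FrameNumericsTwoC σ H L₀ ∧ ‖(ofData d α b hα hb hmin).Λ₀‖ ≤ ((2 : ℝ) ^ (σ.m + 3))⁻¹ ∧
        (d + 1 + 1) * X ≤ σ.Nfin σ.Istar ∧ (d + 1 + 1) * S₀ < σ.Tfin σ.Istar ∧
        σ.D₀ ≤ D₀' ∧ (∀ j, (Fin.snoc (σ.Dbox σ.Istar) (σ.Dθ σ.Istar) : Fin (d + 1) → ℕ) j ≤ D' j) ∧
        GenThreeFrameSpecTwo.RecordTwo C (d + 1) V Vmax W D₀' S₀ X D') :
    GenThreeFramePivotTwo.FrameTwoLast C d := by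
  intro α b V Vmax W hα hind hKZ hV hV1 hVmax hb hmin hW hW1 hneg
  obtain ⟨σ, H, L₀, S₀, X, D₀', D', hnum, hΛ, hX, hT, hD₀, hD, hrec⟩ :=
    h α b V Vmax W hα hind hKZ hV hV1 hVmax hb hmin hW hW1 hneg
  have hK : ∀ κ : Fin (d + 1) → ℕ, (∃ j, ¬ 3 ∣ κ j) → ∀ γ : ℚ,
      ∏ j, (ofData d α b hα hb hmin).toQ.all j ^ κ j ≠ γ ^ 3 := by
    rw [ofData_all]
    exact KummerBasisChange.kummerNat_of_kummerInt 3 α hKZ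
  obtain ⟨hS, hk, hth⟩ := levels_of_numericsC σ hnum hΛ hK
  have hout := frameOutputTwo_of_mainTwo σ (ShFeld σ.Istar H L₀) hS hk hth hX hT
  rw [ofData_all, ofData_ball] at hout
  exact ⟨D₀', S₀, X, D', GenThreeFrameSpecTwo.frameOutputTwo_mono hD₀ hD hout, hrec⟩

/-- **THE REGISTERED STUB'S TEXT FROM THE RECORD, larger END box in the record (sharp count).**
[cite: Yu2007, Main Thm (K = ℚ, ℘ = 2); shape only] -/
theorem stub_frameTwoLast_of_numericsD {C : ℕ → ℝ} {c₁ : ℝ} (hc₁ : 1 ≤ c₁)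
    (hC : ∀ m, 0 ≤ C m ∧ C m ≤ c₁ ^ m) (hC1 : 4 ≤ C 1)
    (h : Nesterenko2003_prop51 → ∀ d, 1 ≤ d →
      ∀ (α : Fin (d + 1) → ℚ) (b : Fin (d + 1) → ℤ) (V : Fin (d + 1) → ℝ) (Vmax W : ℝ)
      (hα : ∀ j, 3 ≤ padicValRat 2 (α j - 1)),
      (∀ μ : Fin (d + 1) → ℤ, ∏ j, α j ^ μ j = 1 → μ = 0) →
      (∀ κ : Fin (d + 1) → ℤ, (∃ γ : ℚ, ∏ j, α j ^ κ j = γ ^ 3) → ∀ j, (3 : ℤ) ∣ κ j) →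
      (∀ j, Height.logHeight₁ (α j) ≤ V j) → (∀ j, 1 ≤ V j) → (∀ j, V j ≤ Vmax) →
      ∀ (hb : b (Fin.last d) ≠ 0)
        (hmin : ∀ j, b j ≠ 0 → padicValInt 2 (b (Fin.last d)) ≤ padicValInt 2 (b j)),
      (∀ j, Real.log (max 3 (|b j| : ℝ)) ≤ W) → 1 ≤ W →
      ¬ (padicValRat 2 (∏ j, α j ^ b j - 1) : ℝ) ≤ C (d + 1) * (∏ j, V j) * (W + Real.log (2 * Vmax)) →
      ∃ (σ : (ofData d α b hα hb hmin).G3TwoSched) (H L₀ S₀ X D₀' : ℕ) (D' : Fin (d + 1) → ℕ),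
        FrameNumericsTwoC σ H L₀ ∧ ‖(ofData d α b hα hb hmin).Λ₀‖ ≤ ((2 : ℝ) ^ (σ.m + 3))⁻¹ ∧
        (d + 1 + 1) * X ≤ σ.Nfin σ.Istar ∧ (d + 1 + 1) * S₀ < σ.Tfin σ.Istar ∧
        σ.D₀ ≤ D₀' ∧ (∀ j, (Fin.snoc (σ.Dbox σ.Istar) (σ.Dθ σ.Istar) : Fin (d + 1) → ℕ) j ≤ D' j) ∧
        GenThreeFrameSpecTwo.RecordTwo C (d + 1) V Vmax W D₀' S₀ X D') :
    ∃ (C : ℕ → ℝ) (c₁ : ℝ), 1 ≤ c₁ ∧ (∀ m, 0 ≤ C m ∧ C m ≤ c₁ ^ m) ∧ 4 ≤ C 1 ∧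
      (Nesterenko2003_prop51 → ∀ d, 1 ≤ d → GenThreeFramePivotTwo.FrameTwoLast C d) :=
  ⟨C, c₁, hc₁, hC, hC1, fun hZ d hd => frameTwoLast_of_numericsD (h hZ d hd)⟩

end TwoSetup

end Summit.ABC.StewartYu

end
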